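import Mathlib
import HarnessLib
import Literature.Analysis.FluidPDE.TypeIAncientMild
import Literature.Analysis.FluidPDE.KochTataruKernel
import Literature.Analysis.FluidPDE.ChaeWolfRemovingDSSBounds
import Literature.Analysis.UnboundedOperators.HeatExtensionDecay
import Summits.NavierStokesRegularity.NavierStokesRegularity.Theorems.PoloidalWindowDoorPoloidalWindowRigidityUniformReturnWindowGap
import Summits.NavierStokesRegularity.NavierStokesRegularity.Theorems.PoloidalWindowDoorPoloidalWindowRigidityEternalCoreParaboloidGapTools

/-!
# Route `PoloidalWindowDoor`, crux `PoloidalWindowRigidity` (stmt-NavierStokesRegularity-19708) — LINE 23 «eternal_core» v1.0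
# (ns-idea-8 g11, `Cruxes/PoloidalWindowRigidity/Lines/eternal_core.lean` 2a19051e6b6d; idea-crit-7 g7 PASS 07:38:50Z): the FORWARD STEP of
# the hand stub U2b `stub_paraboloidGap : ParaboloidGap`

Seat ns-es-p1 g8 (free prover hand on ⟨19708⟩; CLAIM announced on the ideators bus before proposing).  For a Type-I ancient mild profile
`U ∈ A_C` (`Literature.Analysis.FluidPDE.IsTypeIAncientMild C U`), write `ρ = √(−s)` and suppose scale-covariant `2ε`-control
`√(−r)‖U(r,y)‖ ≤ 2ε` is known on the parabolic region `{r ∈ [4t₀, a], ‖y‖ ≤ (R/4)√(−r)}` with `4s ≤ a`, `(1+θ)²s ≤ a`, `t₀ ≤ s < 0`.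

* `heat_part` — the caloric term of the Oseen identity from `4s`: `‖e^{−3sΔ}U(4s)(x)‖ ≤ ε/ρ + 32C/(Rρ)` for `‖x‖ ≤ (R/4)ρ`
  (`U(4s)` is `ε/ρ`-small on `‖x − y‖ ≤ (R/2)ρ = (R/4)√(−4s)` and `C/(2ρ)`-bounded everywhere; `…Tools.norm_heatExtension_le_of_ball_bound`,
  first-moment Markov tail, `√(−3s) ≤ 2ρ`).
* `duhamel_part` — the Duhamel term: `‖B_{4s}(U,U)(s)(x)‖ ≤ (16K₁ε² + 4K₂C²Φ + 2K₁C²√(3θ))/ρ`, `Φ = (θ²R²/16)^{−1/4}`, from ONE integrable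
  `r`-majorant on `(4s, s)`: NEAR times `r ≤ (1+θ)²s` use the near/far spatial split `…Tools.norm_integral_oseenKernel_le_split` with the control
  `2ε/√(−r)` on the ball `‖x − y‖ ≤ d = θ(R/4)ρ` (then `‖y‖ ≤ (1+θ)(R/4)ρ ≤ (R/4)√(−r)`) and the a-priori bound `C/√(−r)` off it; RECENT times
  `r > (1+θ)²s` use `ChaeWolf.norm_integral_oseenKernel_le` with the a-priori bound (indicator term); time weights `ChaeWolf.integral_rpow_sub`,
  `…Tools.integral_rpow_quarter_sub`, `…UniformReturnWindowGap.integral_rpow_sub_Ioo`; every constant is scale-covariant.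
* `step` — both parts and the four scale-free smallness conditions `128C ≤ εR`, `64K₁ε ≤ 1`, `16K₂C²Φ ≤ ε`, `192K₁²C⁴θ ≤ ε²` give
  `√(−s)‖U(s,x)‖ ≤ 2ε` for `‖x‖ ≤ (R/4)√(−s)`.

HONEST LABEL: lemmas for ONE support stub (L) of a files-only PASSed line; nothing here closes a cell, a crux or a route item; ⟨19708⟩ / ⟨20428⟩ and
NS regularity stay OPEN — no summit statement is proved here.
-/

noncomputable section

-- the summit and its single sub-problem share the name (CONVENTIONS §1), as in every Theorems file
set_option linter.dupNamespace false

namespace Summit.NavierStokesRegularity.NavierStokesRegularity.Theorems.PoloidalWindowDoorPoloidalWindowRigidityEternalCoreParaboloidGapStep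

open Set Function Filter MeasureTheory
open Literature.Analysis Literature.Analysis.FluidPDE Literature.Analysis.UnboundedOperators
open Summit.NavierStokesRegularity.NavierStokesRegularity.Theorems.PoloidalWindowDoorPoloidalWindowRigidityUniformReturnWindowGap
open Summit.NavierStokesRegularity.NavierStokesRegularity.Theorems.PoloidalWindowDoorPoloidalWindowRigidityEternalCoreParaboloidGapTools

/-! ## The caloric term -/

/-- **Caloric term of the step** (module docstring): `‖e^{(s−4s)Δ}U(4s)(x)‖ ≤ ε/√(−s) + 32C/(R√(−s))` for `‖x‖ ≤ (R/4)√(−s)`, given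
`2ε`-control at time `4s` on `‖y‖ ≤ (R/4)√(−4s)`. -/
theorem heat_part {C : ℝ} {U : ℝ → EuclideanSpace ℝ (Fin 3) → EuclideanSpace ℝ (Fin 3)} (hU : IsTypeIAncientMild C U)
    {ε R s : ℝ} (hε : 0 < ε) (hR : 0 < R) (hs : s < 0)
    (h4 : ∀ y : EuclideanSpace ℝ (Fin 3), ‖y‖ ≤ R / 4 * Real.sqrt (-(4 * s)) → Real.sqrt (-(4 * s)) * ‖U (4 * s) y‖ ≤ 2 * ε)
    (x : EuclideanSpace ℝ (Fin 3)) (hx : ‖x‖ ≤ R / 4 * Real.sqrt (-s)) :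
    ‖heatExtension (U (4 * s)) (s - 4 * s) x‖ ≤ ε / Real.sqrt (-s) + 32 * C / (R * Real.sqrt (-s)) := by
  have hC : 0 ≤ C := hU.nonneg
  set ρ : ℝ := Real.sqrt (-s) with hρ
  have hρ0 : 0 < ρ := Real.sqrt_pos.2 (by linarith)
  have h4s0 : 4 * s < 0 := by linarith
  have hsq4 : Real.sqrt (-(4 * s)) = 2 * ρ := by rw [ChaeWolf.sqrt_neg_four_mul, ← hρ]
  have ht : 0 < s - 4 * s := by linarith
  have hd : 0 < R / 4 * ρ := by positivity
  have hBall : ∀ z, ‖U (4 * s) z‖ ≤ C / (2 * ρ) := by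
    intro z
    have h := hU.norm_le h4s0 z
    rwa [hsq4] at h
  have hA : ∀ y : EuclideanSpace ℝ (Fin 3), ‖y‖ ≤ R / 4 * ρ → ‖U (4 * s) (x - y)‖ ≤ ε / ρ := by
    intro y hy
    have hxy : ‖x - y‖ ≤ R / 4 * Real.sqrt (-(4 * s)) := by
      rw [hsq4]
      calc ‖x - y‖ ≤ ‖x‖ + ‖y‖ := norm_sub_le _ _
        _ ≤ R / 4 * ρ + R / 4 * ρ := add_le_add hx hy
        _ = R / 4 * (2 * ρ) := by ring
    have h := h4 (x - y) hxy
    rw [hsq4] at h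
    have h2ρ : 0 < 2 * ρ := by positivity
    rw [le_div_iff₀ hρ0]
    calc ‖U (4 * s) (x - y)‖ * ρ = (2 * ρ * ‖U (4 * s) (x - y)‖) / 2 := by ring
      _ ≤ 2 * ε / 2 := by gcongr
      _ = ε := by ring
  have h := norm_heatExtension_le_of_ball_bound ht hd (by positivity) hBall x hA
  refine h.trans ?_
  have hsqrt3 : Real.sqrt (s - 4 * s) ≤ 2 * ρ := by
    have := ChaeWolf.sqrt_neg_three_mul_le s hs
    rw [← hρ] at this
    rwa [show s - 4 * s = -(3 * s) by ring]
  have hcoef : 0 ≤ C / (2 * ρ) / (R / 4 * ρ) := by positivity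
  calc ε / ρ + C / (2 * ρ) / (R / 4 * ρ) * (8 * Real.sqrt (s - 4 * s))
      ≤ ε / ρ + C / (2 * ρ) / (R / 4 * ρ) * (8 * (2 * ρ)) := by gcongr
    _ = ε / ρ + 32 * C / (R * ρ) := by
        field_simp
        ring

/-! ## The Duhamel term -/

/-- **Duhamel term of the step** (module docstring): with `ρ = √(−s)`, `d = θ(R/4)ρ`, `Φ = (θ²R²/16)^{−1/4}`,
`‖B_{4s}(U,U)(s)(x)‖ ≤ (16K₁ε² + 4K₂C²Φ + 2K₁C²√(3θ))/ρ` for `‖x‖ ≤ (R/4)ρ`, given `2ε`-control on `{r ∈ [4t₀, a], ‖y‖ ≤ (R/4)√(−r)}`,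
`(1+θ)²s ≤ a`, `t₀ ≤ s < 0`, `0 < θ ≤ 1`. -/
theorem duhamel_part {C : ℝ} {U : ℝ → EuclideanSpace ℝ (Fin 3) → EuclideanSpace ℝ (Fin 3)} (hU : IsTypeIAncientMild C U)
    {K₁ K₂ : ℝ} (hK₁ : 0 ≤ K₁) (hK₂ : 0 ≤ K₂)
    (hCW : ∀ {τ : ℝ}, 0 < τ → ∀ (x : EuclideanSpace ℝ (Fin 3))
      {f : EuclideanSpace ℝ (Fin 3) → EuclideanSpace ℝ (Fin 3)} {A : ℝ}, (∀ y, ‖f y‖ ≤ A) →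
      ‖∫ y, oseenKernel τ (x - y) (f y) (f y)‖ ≤ K₁ * τ ^ (-(1 / 2 : ℝ)) * A ^ 2)
    (hSP : ∀ {τ : ℝ}, 0 < τ → ∀ (x : EuclideanSpace ℝ (Fin 3))
      {f : EuclideanSpace ℝ (Fin 3) → EuclideanSpace ℝ (Fin 3)} {A B d : ℝ}, 0 < d → 0 ≤ A →
      (∀ y, ‖x - y‖ ≤ d → ‖f y‖ ≤ A) → (∀ y, ‖f y‖ ≤ B) →
      ‖∫ y, oseenKernel τ (x - y) (f y) (f y)‖ ≤
        K₁ * τ ^ (-(1 / 2 : ℝ)) * A ^ 2 + K₂ * (d ^ 2) ^ (-(1 / 4 : ℝ)) * τ ^ (-(1 / 4 : ℝ)) * B ^ 2)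
    {ε θ R t₀ a s : ℝ} (hε : 0 < ε) (hθ0 : 0 < θ) (hθ1 : θ ≤ 1) (hR : 0 < R)
    (ht₀s : t₀ ≤ s) (hs : s < 0) (hθs : (1 + θ) ^ 2 * s ≤ a)
    (hIH : ∀ r : ℝ, 4 * t₀ ≤ r → r ≤ a → ∀ y : EuclideanSpace ℝ (Fin 3), ‖y‖ ≤ R / 4 * Real.sqrt (-r) →
      Real.sqrt (-r) * ‖U r y‖ ≤ 2 * ε)
    (x : EuclideanSpace ℝ (Fin 3)) (hx : ‖x‖ ≤ R / 4 * Real.sqrt (-s)) :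
    ‖oseenDuhamel 1 (4 * s) U U s x‖ ≤
      (16 * K₁ * ε ^ 2 + 4 * K₂ * C ^ 2 * (θ ^ 2 * R ^ 2 / 16) ^ (-(1 / 4 : ℝ)) +
        2 * K₁ * C ^ 2 * Real.sqrt (3 * θ)) / Real.sqrt (-s) := by
  have hC : 0 ≤ C := hU.nonneg
  set ρ : ℝ := Real.sqrt (-s) with hρ
  have hρ0 : 0 < ρ := Real.sqrt_pos.2 (by linarith)
  have hρ2 : ρ ^ 2 = -s := Real.sq_sqrt (by linarith)
  set κ : ℝ := (1 + θ) ^ 2 with hκ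
  have hκ1 : 1 ≤ κ := by rw [hκ]; nlinarith
  have hκ4 : κ ≤ 4 := by rw [hκ]; nlinarith
  have hκ3 : κ - 1 ≤ 3 * θ := by rw [hκ]; nlinarith
  have h4κ : 4 * s ≤ κ * s := mul_le_mul_of_nonpos_right hκ4 hs.le
  have hκs : κ * s ≤ s := by
    have := mul_le_mul_of_nonpos_right hκ1 hs.le
    linarith
  set Φ : ℝ := (θ ^ 2 * R ^ 2 / 16) ^ (-(1 / 4 : ℝ)) with hΦ
  have hΦ0 : 0 ≤ Φ := Real.rpow_nonneg (by positivity) _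
  set d : ℝ := θ * (R / 4) * ρ with hd
  have hd0 : 0 < d := by positivity
  -- control on the known region, in the form `‖U r y‖ ≤ 2ε/√(-r)`
  have hknown : ∀ r : ℝ, 4 * t₀ ≤ r → r ≤ a → r < 0 → ∀ y : EuclideanSpace ℝ (Fin 3),
      ‖y‖ ≤ R / 4 * Real.sqrt (-r) → ‖U r y‖ ≤ 2 * ε / Real.sqrt (-r) := by
    intro r hr1 hr2 hr0 y hy
    have hrr : 0 < Real.sqrt (-r) := Real.sqrt_pos.2 (by linarith)
    rw [le_div_iff₀ hrr, mul_comm]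
    exact hIH r hr1 hr2 y hy
  -- the geometric identity behind the far-field constant: `(d²)^{-1/4} (−3s)^{3/4} ≤ 3 Φ ρ`
  have hd2ρ : (d ^ 2) ^ (-(1 / 4 : ℝ)) * (-(3 * s)) ^ (3 / 4 : ℝ) ≤ 3 * Φ * ρ := by
    have hρ2pos : 0 < ρ ^ 2 := by positivity
    have e1 : d ^ 2 = (θ ^ 2 * R ^ 2 / 16) * ρ ^ 2 := by rw [hd]; ring
    have e2 : -(3 * s) = 3 * ρ ^ 2 := by rw [hρ2]; ring
    rw [e1, e2, Real.mul_rpow (by positivity) hρ2pos.le, Real.mul_rpow (by norm_num) hρ2pos.le, ← hΦ]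
    have e3 : (ρ ^ 2) ^ (-(1 / 4 : ℝ)) * (ρ ^ 2) ^ (3 / 4 : ℝ) = ρ := by
      rw [← Real.rpow_add hρ2pos, show (-(1 / 4 : ℝ)) + 3 / 4 = 1 / 2 by norm_num, ← Real.sqrt_eq_rpow, hρ2, ← hρ]
    have h3 : (3 : ℝ) ^ (3 / 4 : ℝ) ≤ 3 := by
      have h : (3 : ℝ) ^ (3 / 4 : ℝ) ≤ (3 : ℝ) ^ (1 : ℝ) :=
        Real.rpow_le_rpow_of_exponent_le (by norm_num) (by norm_num)
      rwa [Real.rpow_one] at h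
    calc Φ * (ρ ^ 2) ^ (-(1 / 4 : ℝ)) * ((3 : ℝ) ^ (3 / 4 : ℝ) * (ρ ^ 2) ^ (3 / 4 : ℝ))
        = (3 : ℝ) ^ (3 / 4 : ℝ) * Φ * ((ρ ^ 2) ^ (-(1 / 4 : ℝ)) * (ρ ^ 2) ^ (3 / 4 : ℝ)) := by ring
      _ = (3 : ℝ) ^ (3 / 4 : ℝ) * Φ * ρ := by rw [e3]
      _ ≤ 3 * Φ * ρ := by gcongr
  -- the majorant
  set g : ℝ → ℝ := fun r =>
    K₁ * (4 * ε ^ 2 / ρ ^ 2) * (s - r) ^ (-(1 / 2 : ℝ)) +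
      K₂ * (d ^ 2) ^ (-(1 / 4 : ℝ)) * (C ^ 2 / ρ ^ 2) * (s - r) ^ (-(1 / 4 : ℝ)) +
      (Ioi (κ * s)).indicator (fun r => K₁ * (C ^ 2 / ρ ^ 2) * (s - r) ^ (-(1 / 2 : ℝ))) r with hg
  have hw2_int : IntegrableOn (fun r : ℝ => (s - r) ^ (-(1 / 2 : ℝ))) (Ioo (4 * s) s) :=
    ChaeWolf.integrableOn_rpow_sub hs
  have hw4_int : IntegrableOn (fun r : ℝ => (s - r) ^ (-(1 / 4 : ℝ))) (Ioo (4 * s) s) :=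
    integrableOn_rpow_quarter_sub hs
  have hg1_int : IntegrableOn (fun r : ℝ => K₁ * (4 * ε ^ 2 / ρ ^ 2) * (s - r) ^ (-(1 / 2 : ℝ))) (Ioo (4 * s) s) :=
    hw2_int.const_mul _
  have hg2_int : IntegrableOn
      (fun r : ℝ => K₂ * (d ^ 2) ^ (-(1 / 4 : ℝ)) * (C ^ 2 / ρ ^ 2) * (s - r) ^ (-(1 / 4 : ℝ))) (Ioo (4 * s) s) :=
    hw4_int.const_mul _
  have hg3_int : IntegrableOn
      (fun r : ℝ => (Ioi (κ * s)).indicator (fun r => K₁ * (C ^ 2 / ρ ^ 2) * (s - r) ^ (-(1 / 2 : ℝ))) r)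
      (Ioo (4 * s) s) := (hw2_int.const_mul _).indicator measurableSet_Ioi
  have hg12_int : IntegrableOn
      (fun r : ℝ => K₁ * (4 * ε ^ 2 / ρ ^ 2) * (s - r) ^ (-(1 / 2 : ℝ)) +
        K₂ * (d ^ 2) ^ (-(1 / 4 : ℝ)) * (C ^ 2 / ρ ^ 2) * (s - r) ^ (-(1 / 4 : ℝ))) (Ioo (4 * s) s) :=
    hg1_int.add hg2_int
  have hG : IntegrableOn g (Ioo (4 * s) s) := hg12_int.add hg3_int
  rw [oseenDuhamel_apply]
  have hpt : ∀ᵐ r ∂(volume.restrict (Ioo (4 * s) s)),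
      ‖∫ y, oseenKernel (1 * (s - r)) (x - y) (U r y) (U r y)‖ ≤ g r := by
    refine ae_restrict_of_forall_mem measurableSet_Ioo fun r hr => ?_
    have hr0 : r < 0 := hr.2.trans hs
    have hτ : 0 < s - r := by linarith only [hr.2]
    have hw0 : 0 ≤ (s - r) ^ (-(1 / 2 : ℝ)) := Real.rpow_nonneg hτ.le _
    have hw0' : 0 ≤ (s - r) ^ (-(1 / 4 : ℝ)) := Real.rpow_nonneg hτ.le _
    have hdq : 0 ≤ (d ^ 2) ^ (-(1 / 4 : ℝ)) := Real.rpow_nonneg (by positivity) _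
    have hσr : ρ ^ 2 ≤ -r := by rw [hρ2]; linarith only [hr.2]
    have hB : ∀ y, ‖U r y‖ ≤ C / Real.sqrt (-r) := fun y => hU.norm_le hr0 y
    have hsqB : (C / Real.sqrt (-r)) ^ 2 = C ^ 2 / (-r) := by rw [div_pow, Real.sq_sqrt (by linarith only [hr0])]
    have hfracB : C ^ 2 / (-r) ≤ C ^ 2 / ρ ^ 2 := div_le_div_of_nonneg_left (sq_nonneg C) (by positivity) hσr
    have hg1nn : 0 ≤ K₁ * (4 * ε ^ 2 / ρ ^ 2) * (s - r) ^ (-(1 / 2 : ℝ)) := by positivity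
    have hg2nn : 0 ≤ K₂ * (d ^ 2) ^ (-(1 / 4 : ℝ)) * (C ^ 2 / ρ ^ 2) * (s - r) ^ (-(1 / 4 : ℝ)) := by positivity
    rw [one_mul]
    rcases le_or_gt r (κ * s) with hrn | hrn
    · -- NEAR time: the slice `U r` is controlled on the ball `‖x - y‖ ≤ d`
      have hra : r ≤ a := hrn.trans hθs
      have hA : ∀ y, ‖x - y‖ ≤ d → ‖U r y‖ ≤ 2 * ε / Real.sqrt (-r) := by
        intro y hy
        refine hknown r (by linarith only [hr.1, ht₀s]) hra hr0 y ?_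
        -- `‖y‖ ≤ (1+θ)(R/4)ρ ≤ (R/4)√(-r)`
        have h1 : ‖y‖ ≤ (1 + θ) * (R / 4 * ρ) := by
          calc ‖y‖ = ‖x - (x - y)‖ := by rw [sub_sub_cancel]
            _ ≤ ‖x‖ + ‖x - y‖ := norm_sub_le _ _
            _ ≤ R / 4 * ρ + d := add_le_add hx hy
            _ = (1 + θ) * (R / 4 * ρ) := by rw [hd]; ring
        have h2 : (1 + θ) * ρ ≤ Real.sqrt (-r) := by
          have h3 : Real.sqrt (((1 + θ) * ρ) ^ 2) ≤ Real.sqrt (-r) := by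
            apply Real.sqrt_le_sqrt
            have e : ((1 + θ) * ρ) ^ 2 = κ * (-s) := by rw [mul_pow, hρ2]
            rw [e]
            linarith only [hrn]
          rwa [Real.sqrt_sq (by positivity)] at h3
        calc ‖y‖ ≤ (1 + θ) * (R / 4 * ρ) := h1
          _ = R / 4 * ((1 + θ) * ρ) := by ring
          _ ≤ R / 4 * Real.sqrt (-r) := by gcongr
      have h1 := hSP hτ x hd0 (by positivity) hA hB
      refine h1.trans ?_
      have hsqA : (2 * ε / Real.sqrt (-r)) ^ 2 = 4 * ε ^ 2 / (-r) := by
        rw [div_pow, Real.sq_sqrt (by linarith only [hr0])]; ring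
      rw [hsqA, hsqB]
      have hfracA : 4 * ε ^ 2 / (-r) ≤ 4 * ε ^ 2 / ρ ^ 2 :=
        div_le_div_of_nonneg_left (by positivity) (by positivity) hσr
      have hind : 0 ≤ (Ioi (κ * s)).indicator (fun r => K₁ * (C ^ 2 / ρ ^ 2) * (s - r) ^ (-(1 / 2 : ℝ))) r := by
        rw [indicator_of_notMem (notMem_Ioi.2 hrn)]
      calc K₁ * (s - r) ^ (-(1 / 2 : ℝ)) * (4 * ε ^ 2 / -r) +
            K₂ * (d ^ 2) ^ (-(1 / 4 : ℝ)) * (s - r) ^ (-(1 / 4 : ℝ)) * (C ^ 2 / -r)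
          ≤ K₁ * (s - r) ^ (-(1 / 2 : ℝ)) * (4 * ε ^ 2 / ρ ^ 2) +
            K₂ * (d ^ 2) ^ (-(1 / 4 : ℝ)) * (s - r) ^ (-(1 / 4 : ℝ)) * (C ^ 2 / ρ ^ 2) := by gcongr
        _ = K₁ * (4 * ε ^ 2 / ρ ^ 2) * (s - r) ^ (-(1 / 2 : ℝ)) +
            K₂ * (d ^ 2) ^ (-(1 / 4 : ℝ)) * (C ^ 2 / ρ ^ 2) * (s - r) ^ (-(1 / 4 : ℝ)) := by ring
        _ ≤ g r := le_add_of_nonneg_right hind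
    · -- RECENT time: a-priori Type-I bound everywhere
      have h1 := hCW hτ x hB
      refine h1.trans ?_
      rw [hsqB]
      have hind : (Ioi (κ * s)).indicator (fun r => K₁ * (C ^ 2 / ρ ^ 2) * (s - r) ^ (-(1 / 2 : ℝ))) r =
            K₁ * (C ^ 2 / ρ ^ 2) * (s - r) ^ (-(1 / 2 : ℝ)) :=
        indicator_of_mem (mem_Ioi.2 hrn) _
      have hgr : g r = K₁ * (4 * ε ^ 2 / ρ ^ 2) * (s - r) ^ (-(1 / 2 : ℝ)) +
          K₂ * (d ^ 2) ^ (-(1 / 4 : ℝ)) * (C ^ 2 / ρ ^ 2) * (s - r) ^ (-(1 / 4 : ℝ)) +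
          K₁ * (C ^ 2 / ρ ^ 2) * (s - r) ^ (-(1 / 2 : ℝ)) := by
        rw [hg]
        dsimp only
        rw [hind]
      calc K₁ * (s - r) ^ (-(1 / 2 : ℝ)) * (C ^ 2 / -r)
          ≤ K₁ * (s - r) ^ (-(1 / 2 : ℝ)) * (C ^ 2 / ρ ^ 2) := by gcongr
        _ = K₁ * (C ^ 2 / ρ ^ 2) * (s - r) ^ (-(1 / 2 : ℝ)) := by ring
        _ ≤ g r := by rw [hgr]; linarith only [hg1nn, hg2nn]
  refine (norm_integral_le_of_norm_le hG hpt).trans ?_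
  -- evaluate the majorant
  have hI1 : ∫ r in Ioo (4 * s) s, K₁ * (4 * ε ^ 2 / ρ ^ 2) * (s - r) ^ (-(1 / 2 : ℝ)) =
      K₁ * (4 * ε ^ 2 / ρ ^ 2) * (2 * Real.sqrt (-(3 * s))) := by
    rw [MeasureTheory.integral_const_mul, ChaeWolf.integral_rpow_sub hs]
  have hI2 : ∫ r in Ioo (4 * s) s, K₂ * (d ^ 2) ^ (-(1 / 4 : ℝ)) * (C ^ 2 / ρ ^ 2) * (s - r) ^ (-(1 / 4 : ℝ)) =
      K₂ * (d ^ 2) ^ (-(1 / 4 : ℝ)) * (C ^ 2 / ρ ^ 2) * (4 / 3 * (-(3 * s)) ^ (3 / 4 : ℝ)) := by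
    rw [MeasureTheory.integral_const_mul, integral_rpow_quarter_sub hs]
  have hI3 : ∫ r in Ioo (4 * s) s,
      (Ioi (κ * s)).indicator (fun r => K₁ * (C ^ 2 / ρ ^ 2) * (s - r) ^ (-(1 / 2 : ℝ))) r =
        K₁ * (C ^ 2 / ρ ^ 2) * (2 * Real.sqrt (s - κ * s)) := by
    rw [integral_indicator measurableSet_Ioi, Measure.restrict_restrict measurableSet_Ioi,
      Ioi_inter_Ioo_of_le h4κ, MeasureTheory.integral_const_mul, integral_rpow_sub_Ioo hκs]
  have hsum : ∫ r in Ioo (4 * s) s, g r =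
      K₁ * (4 * ε ^ 2 / ρ ^ 2) * (2 * Real.sqrt (-(3 * s))) +
        K₂ * (d ^ 2) ^ (-(1 / 4 : ℝ)) * (C ^ 2 / ρ ^ 2) * (4 / 3 * (-(3 * s)) ^ (3 / 4 : ℝ)) +
        K₁ * (C ^ 2 / ρ ^ 2) * (2 * Real.sqrt (s - κ * s)) := by
    rw [hg]
    dsimp only
    rw [integral_add hg12_int hg3_int, integral_add hg1_int hg2_int, hI1, hI2, hI3]
  rw [hsum]
  have h3 := ChaeWolf.sqrt_neg_three_mul_le s hs
  rw [← hρ] at h3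
  -- the recent stretch: `√(s - κ s) = √((κ - 1)(-s)) ≤ √(3θ) ρ`
  have hrec : Real.sqrt (s - κ * s) ≤ Real.sqrt (3 * θ) * ρ := by
    rw [hρ, ← Real.sqrt_mul' _ (by linarith only [hs])]
    apply Real.sqrt_le_sqrt
    have hk : s - κ * s = (κ - 1) * (-s) := by ring
    rw [hk]
    exact mul_le_mul_of_nonneg_right hκ3 (by linarith only [hs])
  have hrr : ρ ^ 2 = ρ * ρ := sq ρ
  have hfirst : K₁ * (4 * ε ^ 2 / ρ ^ 2) * (2 * Real.sqrt (-(3 * s))) ≤ 16 * K₁ * ε ^ 2 / ρ := by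
    calc K₁ * (4 * ε ^ 2 / ρ ^ 2) * (2 * Real.sqrt (-(3 * s)))
        ≤ K₁ * (4 * ε ^ 2 / ρ ^ 2) * (2 * (2 * ρ)) := by gcongr
      _ = 16 * K₁ * ε ^ 2 / ρ := by rw [hrr]; field_simp; ring
  have hmid : K₂ * (d ^ 2) ^ (-(1 / 4 : ℝ)) * (C ^ 2 / ρ ^ 2) * (4 / 3 * (-(3 * s)) ^ (3 / 4 : ℝ)) ≤
      4 * K₂ * C ^ 2 * Φ / ρ := by
    have e : K₂ * (d ^ 2) ^ (-(1 / 4 : ℝ)) * (C ^ 2 / ρ ^ 2) * (4 / 3 * (-(3 * s)) ^ (3 / 4 : ℝ)) =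
        4 / 3 * K₂ * (C ^ 2 / ρ ^ 2) * ((d ^ 2) ^ (-(1 / 4 : ℝ)) * (-(3 * s)) ^ (3 / 4 : ℝ)) := by ring
    rw [e]
    calc 4 / 3 * K₂ * (C ^ 2 / ρ ^ 2) * ((d ^ 2) ^ (-(1 / 4 : ℝ)) * (-(3 * s)) ^ (3 / 4 : ℝ))
        ≤ 4 / 3 * K₂ * (C ^ 2 / ρ ^ 2) * (3 * Φ * ρ) := by gcongr
      _ = 4 * K₂ * C ^ 2 * Φ / ρ := by rw [hrr]; field_simp
  have hthird : K₁ * (C ^ 2 / ρ ^ 2) * (2 * Real.sqrt (s - κ * s)) ≤ 2 * K₁ * C ^ 2 * Real.sqrt (3 * θ) / ρ := by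
    calc K₁ * (C ^ 2 / ρ ^ 2) * (2 * Real.sqrt (s - κ * s))
        ≤ K₁ * (C ^ 2 / ρ ^ 2) * (2 * (Real.sqrt (3 * θ) * ρ)) := by gcongr
      _ = 2 * K₁ * C ^ 2 * Real.sqrt (3 * θ) / ρ := by rw [hrr]; field_simp
  rw [add_div, add_div]
  exact add_le_add (add_le_add hfirst hmid) hthird

/-! ## The step -/

/-- **One forward step of the paraboloid gap** (module docstring): both parts of the Oseen identity from `4s` and the four scale-free
smallness conditions give `√(−s)‖U(s, x)‖ ≤ 2ε` for `‖x‖ ≤ (R/4)√(−s)`. -/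
theorem step {C : ℝ} {U : ℝ → EuclideanSpace ℝ (Fin 3) → EuclideanSpace ℝ (Fin 3)} (hU : IsTypeIAncientMild C U)
    {K₁ K₂ : ℝ} (hK₁ : 0 ≤ K₁) (hK₂ : 0 ≤ K₂)
    (hCW : ∀ {τ : ℝ}, 0 < τ → ∀ (x : EuclideanSpace ℝ (Fin 3))
      {f : EuclideanSpace ℝ (Fin 3) → EuclideanSpace ℝ (Fin 3)} {A : ℝ}, (∀ y, ‖f y‖ ≤ A) →
      ‖∫ y, oseenKernel τ (x - y) (f y) (f y)‖ ≤ K₁ * τ ^ (-(1 / 2 : ℝ)) * A ^ 2)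
    (hSP : ∀ {τ : ℝ}, 0 < τ → ∀ (x : EuclideanSpace ℝ (Fin 3))
      {f : EuclideanSpace ℝ (Fin 3) → EuclideanSpace ℝ (Fin 3)} {A B d : ℝ}, 0 < d → 0 ≤ A →
      (∀ y, ‖x - y‖ ≤ d → ‖f y‖ ≤ A) → (∀ y, ‖f y‖ ≤ B) →
      ‖∫ y, oseenKernel τ (x - y) (f y) (f y)‖ ≤
        K₁ * τ ^ (-(1 / 2 : ℝ)) * A ^ 2 + K₂ * (d ^ 2) ^ (-(1 / 4 : ℝ)) * τ ^ (-(1 / 4 : ℝ)) * B ^ 2)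
    {ε θ R t₀ a s : ℝ} (hε : 0 < ε) (hθ0 : 0 < θ) (hθ1 : θ ≤ 1) (hR : 0 < R)
    (hc1 : 128 * C ≤ ε * R) (hc2 : 64 * K₁ * ε ≤ 1)
    (hc3 : 16 * K₂ * C ^ 2 * (θ ^ 2 * R ^ 2 / 16) ^ (-(1 / 4 : ℝ)) ≤ ε) (hc4 : 192 * K₁ ^ 2 * C ^ 4 * θ ≤ ε ^ 2)
    (ht₀s : t₀ ≤ s) (hs : s < 0) (h4s : 4 * s ≤ a) (hθs : (1 + θ) ^ 2 * s ≤ a)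
    (hIH : ∀ r : ℝ, 4 * t₀ ≤ r → r ≤ a → ∀ y : EuclideanSpace ℝ (Fin 3), ‖y‖ ≤ R / 4 * Real.sqrt (-r) →
      Real.sqrt (-r) * ‖U r y‖ ≤ 2 * ε)
    (x : EuclideanSpace ℝ (Fin 3)) (hx : ‖x‖ ≤ R / 4 * Real.sqrt (-s)) : Real.sqrt (-s) * ‖U s x‖ ≤ 2 * ε := by
  have hC : 0 ≤ C := hU.nonneg
  set ρ : ℝ := Real.sqrt (-s) with hρ
  have hρ0 : 0 < ρ := Real.sqrt_pos.2 (by linarith)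
  set Φ : ℝ := (θ ^ 2 * R ^ 2 / 16) ^ (-(1 / 4 : ℝ)) with hΦ
  have hΦ0 : 0 ≤ Φ := Real.rpow_nonneg (by positivity) _
  -- the Oseen identity of the class between `4s` and `s`
  have hmild : U s x = heatExtension (U (4 * s)) (s - 4 * s) x - oseenDuhamel 1 (4 * s) U U s x :=
    hU.mild_eq_heatExtension (by linarith) hs x
  have h4 : ∀ y : EuclideanSpace ℝ (Fin 3), ‖y‖ ≤ R / 4 * Real.sqrt (-(4 * s)) →
      Real.sqrt (-(4 * s)) * ‖U (4 * s) y‖ ≤ 2 * ε := fun y hy => hIH (4 * s) (by linarith) h4s y hy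
  have hheat := heat_part hU hε hR hs h4 x hx
  have hduh := duhamel_part hU hK₁ hK₂ hCW hSP hε hθ0 hθ1 hR ht₀s hs hθs hIH x hx
  rw [← hρ] at hheat hduh
  rw [← hΦ] at hduh
  -- the four scale-free smallness conditions
  have hq1 : 32 * C / R ≤ ε / 4 := by
    rw [div_le_iff₀ hR]
    linarith only [hc1]
  have hq2 : 16 * K₁ * ε ^ 2 ≤ ε / 4 := by
    have e : 16 * K₁ * ε ^ 2 = (64 * K₁ * ε) * ε / 4 := by ring
    rw [e]
    have h2 : (64 * K₁ * ε) * ε ≤ 1 * ε := mul_le_mul_of_nonneg_right hc2 hε.le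
    linarith only [h2]
  have hq3 : 4 * K₂ * C ^ 2 * Φ ≤ ε / 4 := by linarith only [hc3]
  have hq4 : 2 * K₁ * C ^ 2 * Real.sqrt (3 * θ) ≤ ε / 4 := by
    have e : (8 * K₁ * C ^ 2) ^ 2 * (3 * θ) = 192 * K₁ ^ 2 * C ^ 4 * θ := by ring
    have h1 : Real.sqrt ((8 * K₁ * C ^ 2) ^ 2 * (3 * θ)) ≤ Real.sqrt (ε ^ 2) := Real.sqrt_le_sqrt (by rw [e]; exact hc4)
    rw [Real.sqrt_mul' _ (by positivity), Real.sqrt_sq (by positivity), Real.sqrt_sq hε.le] at h1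
    linarith only [h1]
  -- assemble
  have hnorm : ‖U s x‖ ≤ (ε / ρ + 32 * C / (R * ρ)) +
      (16 * K₁ * ε ^ 2 + 4 * K₂ * C ^ 2 * Φ + 2 * K₁ * C ^ 2 * Real.sqrt (3 * θ)) / ρ := by
    rw [hmild]
    exact (norm_sub_le _ _).trans (add_le_add hheat hduh)
  have hfin : ρ * ‖U s x‖ ≤ ε + 32 * C / R + (16 * K₁ * ε ^ 2 + 4 * K₂ * C ^ 2 * Φ + 2 * K₁ * C ^ 2 * Real.sqrt (3 * θ)) := by
    calc ρ * ‖U s x‖ ≤ ρ * ((ε / ρ + 32 * C / (R * ρ)) +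
        (16 * K₁ * ε ^ 2 + 4 * K₂ * C ^ 2 * Φ + 2 * K₁ * C ^ 2 * Real.sqrt (3 * θ)) / ρ) := by
          gcongr
      _ = ε + 32 * C / R + (16 * K₁ * ε ^ 2 + 4 * K₂ * C ^ 2 * Φ + 2 * K₁ * C ^ 2 * Real.sqrt (3 * θ)) := by
          field_simp
  linarith only [hfin, hq1, hq2, hq3, hq4]

end Summit.NavierStokesRegularity.NavierStokesRegularity.Theorems.PoloidalWindowDoorPoloidalWindowRigidityEternalCoreParaboloidGapStep

end
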